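import Literature.Geometry.Lorentzian.KerrCylinderDatum
import HarnessLib

/-!
# The Kerr-cylinder metric to first order in the spin: Li–Mei (4.2), first line

Support file (all results proved; no named facts) for the named fact `LiMei.interiorKerrGluing`
(`InteriorKerrGluing.lean`; J. Li, H. Mei, *A construction of collapsing spacetimes in vacuum*,
Comm. Math. Phys. 378 (2020) = arXiv:2005.01249, Prop. 4.1). Li–Mei (4.2): "What we need to know
is the exact differences between Kerr and Schwarzschild up to `a` to the first order. By direct
computation, `ḡ_{m,a} = ḡ_m − 4 m a r₀⁻¹ sin²θ dt dφ + O(a²)`, …". This file carries out that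
direct computation for the METRIC of the tree's Kerr cylinder (the pulled-back metric
`H₀ = cylH₀ m a r₀ τ₀ id` of `KerrCylinderDatum.lean`, axis `e₃`, in the Cartesian coordinates `y`
of the cylinder `E3 ∖ 0`, `t* = ‖y‖ + τ₀`):

* `cylH₀_id_apply_eq` — **a closed form of `H₀(y)(v, w)` as a rational function of `a`**: with
  `n = y/‖y‖`, `q_v = v/‖y‖ − ⟪y, v⟫ y/‖y‖³` (so that `dψ_a v = (⟪n, v⟫, E_a q_v)`,
  `E_a = diag(√(r₀² + a²), √(r₀² + a²), r₀)`), on the cylinder `r ≡ r₀`,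
  `H = m r₀/(r₀² + a² n₃²)` and the null covector is AFFINE in `a`:
  `ℓ(dψ_a v) = ⟪n, v⟫ + r₀ ⟪n, q_v⟫ + a (n₂ q_{v,1} − n₁ q_{v,2})`;
* `hasDerivAt_cylH₀_spin` — **the first-order term**:
  `∂_a|_{a=0} H₀(y)(v, w) = (2m/(r₀‖y‖³)) ((y₂v₁ − y₁v₂) ⟪y, w⟫ + ⟪y, v⟫ (y₂w₁ − y₁w₂))`, which is
  Li–Mei's `−4 m r₀⁻¹ sin²θ dt dφ` evaluated on `(dψ v, dψ w)` (`dt(dψ v) = ⟪n, v⟫`,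
  `r₀² sin²θ dφ(dψ w) = (x₁ u₂ − x₂ u₁) = −r₀ (y₂w₁ − y₁w₂)/‖y‖`; indices `1, 2, 3` of the paper are
  the tree's `0, 1, 2`).

## References

* J. Li, H. Mei, *A construction of collapsing spacetimes in vacuum*, Comm. Math. Phys. 378
  (2020), arXiv:2005.01249, §4, (4.2) (key `LiMei2020`).
* R. P. Kerr, A. Schild (1965), §3; M. Visser, arXiv:0706.0622, (32)–(35) (key `KerrSchild1965`).
-/

noncomputable section

open Set Filter Function Metric
open scoped Topology RealInnerProductSpace

namespace Literature.Geometry.Lorentzian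

namespace LiMei

/-! ### The unit direction and the tangential part -/

/-- The unit direction `n = y/‖y‖`. [folklore] -/
def dirVec (y : E3) : E3 := ‖y‖⁻¹ • y

/-- The vector `q_v = v/‖y‖ − ⟪y, v⟫ y/‖y‖³` with `dψ_a v = (⟪n, v⟫, E_a q_v)`
(`kerrCylDeriv_apply`). [folklore] -/
def tanVec (y v : E3) : E3 := ‖y‖⁻¹ • v + (-1 / ‖y‖ ^ 3 * ⟪y, v⟫) • y

/-- Components of `n`. [folklore] -/
@[simp]
theorem dirVec_apply (y : E3) (i : Fin 3) : dirVec y i = ‖y‖⁻¹ * y i := by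
  simp [dirVec]

/-- Components of `q_v`. [folklore] -/
@[simp]
theorem tanVec_apply (y v : E3) (i : Fin 3) :
    tanVec y v i = ‖y‖⁻¹ * v i + -1 / ‖y‖ ^ 3 * ⟪y, v⟫ * y i := by
  simp [tanVec]

/-- `q_v ⊥ n`: `⟪n, q_v⟫ = 0` (`y ≠ 0`). [folklore] -/
theorem inner_dirVec_tanVec {y : E3} (hy : y ≠ 0) (v : E3) : ⟪dirVec y, tanVec y v⟫ = 0 := by
  have hn : ‖y‖ ≠ 0 := norm_ne_zero_iff.2 hy
  have hyy : ⟪y, y⟫ = ‖y‖ ^ 2 := real_inner_self_eq_norm_sq y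
  simp only [dirVec, tanVec, inner_add_right, inner_smul_left, inner_smul_right, conj_trivial, hyy]
  field_simp
  ring

/-- The twist `n₂ q_{v,1} − n₁ q_{v,2} = (y₂ v₁ − y₁ v₂)/‖y‖²` (tree indices `1, 0`). [folklore] -/
theorem dirVec_twist {y : E3} (hy : y ≠ 0) (v : E3) :
    dirVec y 1 * tanVec y v 0 - dirVec y 0 * tanVec y v 1 = (y 1 * v 0 - y 0 * v 1) / ‖y‖ ^ 2 := by
  have hn : ‖y‖ ≠ 0 := norm_ne_zero_iff.2 hy
  simp only [dirVec_apply, tanVec_apply]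
  field_simp
  ring

/-! ### Components of the cylinder map and of its differential -/

/-- Time component of the cylinder map. [folklore] -/
theorem kerrCylMap_id_apply_zero (r₀ a τ₀ : ℝ) (y : E3) :
    kerrCylMap r₀ a τ₀ LinearIsometry.id y 0 = ‖y‖ + τ₀ := rfl

/-- Spatial components `1, 2` of the cylinder map: `√(r₀² + a²) nᵢ`. [folklore] -/
theorem kerrCylMap_id_apply_one (r₀ a τ₀ : ℝ) (y : E3) :
    kerrCylMap r₀ a τ₀ LinearIsometry.id y 1 = Real.sqrt (r₀ ^ 2 + a ^ 2) * dirVec y 0 := rfl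

/-- Spatial component `2`. [folklore] -/
theorem kerrCylMap_id_apply_two (r₀ a τ₀ : ℝ) (y : E3) :
    kerrCylMap r₀ a τ₀ LinearIsometry.id y 2 = Real.sqrt (r₀ ^ 2 + a ^ 2) * dirVec y 1 := rfl

/-- Spatial component `3`: `r₀ n₃`. [folklore] -/
theorem kerrCylMap_id_apply_three (r₀ a τ₀ : ℝ) (y : E3) :
    kerrCylMap r₀ a τ₀ LinearIsometry.id y 3 = r₀ * dirVec y 2 := rfl

/-- Time component of `dψ_a v`: `⟪n, v⟫`. [folklore] -/
theorem kerrCylDeriv_id_apply_zero (r₀ a : ℝ) (y v : E3) :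
    kerrCylDeriv r₀ a LinearIsometry.id y v 0 = ‖y‖⁻¹ * ⟪y, v⟫ :=
  kerrCylDeriv_apply_zero r₀ a _ y v

/-- Spatial components of `dψ_a v`: `(dψ_a v)_{i+1} = (E_a q_v)_i`. [folklore] -/
theorem kerrCylDeriv_id_apply_succ (r₀ a : ℝ) (y v : E3) (i : Fin 3) :
    kerrCylDeriv r₀ a LinearIsometry.id y v i.succ = ellipsoidPt r₀ a (tanVec y v) i :=
  congrArg (fun z : E3 ↦ z i) (spatial_kerrCylDeriv r₀ a LinearIsometry.id y v)

/-- Spatial component `1` of `dψ_a v`: `√(r₀² + a²) q_{v,1}`. [folklore] -/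
theorem kerrCylDeriv_id_apply_one (r₀ a : ℝ) (y v : E3) :
    kerrCylDeriv r₀ a LinearIsometry.id y v 1 = Real.sqrt (r₀ ^ 2 + a ^ 2) * tanVec y v 0 :=
  kerrCylDeriv_id_apply_succ r₀ a y v 0

/-- Spatial component `2` of `dψ_a v`. [folklore] -/
theorem kerrCylDeriv_id_apply_two (r₀ a : ℝ) (y v : E3) :
    kerrCylDeriv r₀ a LinearIsometry.id y v 2 = Real.sqrt (r₀ ^ 2 + a ^ 2) * tanVec y v 1 :=
  kerrCylDeriv_id_apply_succ r₀ a y v 1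

/-- Spatial component `3` of `dψ_a v`: `r₀ q_{v,3}`. [folklore] -/
theorem kerrCylDeriv_id_apply_three (r₀ a : ℝ) (y v : E3) :
    kerrCylDeriv r₀ a LinearIsometry.id y v 3 = r₀ * tanVec y v 2 :=
  kerrCylDeriv_id_apply_succ r₀ a y v 2

/-! ### The three ingredients of `g = η + 2H ℓ ⊗ ℓ` along the cylinder -/

/-- **`η(dψ_a v, dψ_a w)` in closed form** (quadratic in `a`). [folklore] -/
theorem minkowski_kerrCylDeriv_id (r₀ a : ℝ) (y v w : E3) :
    Minkowski.bilin (kerrCylDeriv r₀ a LinearIsometry.id y v) (kerrCylDeriv r₀ a LinearIsometry.id y w) =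
      -(‖y‖⁻¹ * ⟪y, v⟫ * (‖y‖⁻¹ * ⟪y, w⟫)) +
        (r₀ ^ 2 + a ^ 2) * (tanVec y v 0 * tanVec y w 0 + tanVec y v 1 * tanVec y w 1) +
        r₀ ^ 2 * (tanVec y v 2 * tanVec y w 2) := by
  rw [Minkowski.bilin_apply, Fin.sum_univ_three]
  simp only [Fin.succ_zero_eq_one, Fin.succ_one_eq_two, show (2 : Fin 3).succ = (3 : Fin 4) from rfl,
    kerrCylDeriv_id_apply_zero, kerrCylDeriv_id_apply_one, kerrCylDeriv_id_apply_two,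
    kerrCylDeriv_id_apply_three]
  set c : ℝ := Real.sqrt (r₀ ^ 2 + a ^ 2) with hc
  have hc2 : c ^ 2 = r₀ ^ 2 + a ^ 2 := Real.sq_sqrt (by positivity)
  rw [← hc2]
  ring

/-- **`H = m r₀/(r₀² + a² n₃²)` on the cylinder** (`0 < r₀`, `y ≠ 0`; `r ≡ r₀` there).
[cite: KerrSchild1965, §3] -/
theorem scalarH_kerrCylMap_id (m : ℝ) {r₀ : ℝ} (hr₀ : 0 < r₀) (a τ₀ : ℝ) {y : E3} (hy : y ≠ 0) :
    Kerr.scalarH m a (kerrCylMap r₀ a τ₀ LinearIsometry.id y) =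
      m * r₀ / (r₀ ^ 2 + a ^ 2 * dirVec y 2 ^ 2) := by
  unfold Kerr.scalarH
  rw [radius_kerrCylMap hr₀.le a τ₀ _ hy, kerrCylMap_id_apply_three]
  have h1 : r₀ ^ 2 + a ^ 2 * dirVec y 2 ^ 2 ≠ 0 := by positivity
  have h2 : r₀ ^ 4 + a ^ 2 * (r₀ * dirVec y 2) ^ 2 ≠ 0 := by positivity
  rw [div_eq_div_iff h2 h1]
  ring

/-- **The null covector along the cylinder is affine in the spin**:
`ℓ(dψ_a v) = ⟪n, v⟫ + r₀ ⟪n, q_v⟫ + a (n₂ q_{v,1} − n₁ q_{v,2})` (`0 < r₀`, `y ≠ 0`).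
[cite: KerrSchild1965, §3] -/
theorem nullCovector_kerrCylDeriv_id {r₀ : ℝ} (hr₀ : 0 < r₀) (a τ₀ : ℝ) {y : E3} (hy : y ≠ 0)
    (v : E3) :
    Kerr.nullCovector a (kerrCylMap r₀ a τ₀ LinearIsometry.id y) (kerrCylDeriv r₀ a LinearIsometry.id y v) =
      ‖y‖⁻¹ * ⟪y, v⟫ + r₀ * ⟪dirVec y, tanVec y v⟫ +
        a * (dirVec y 1 * tanVec y v 0 - dirVec y 0 * tanVec y v 1) := by
  set c : ℝ := Real.sqrt (r₀ ^ 2 + a ^ 2) with hc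
  have hc2 : c ^ 2 = r₀ ^ 2 + a ^ 2 := Real.sq_sqrt (by positivity)
  have hc0 : c ≠ 0 := by
    rw [hc]; exact Real.sqrt_ne_zero'.2 (by positivity)
  have hin : ⟪dirVec y, tanVec y v⟫ =
      dirVec y 0 * tanVec y v 0 + dirVec y 1 * tanVec y v 1 + dirVec y 2 * tanVec y v 2 := by
    rw [PiLp.inner_apply, Fin.sum_univ_three]
    simp only [RCLike.inner_apply, conj_trivial]
    ring
  rw [Kerr.nullCovector, E4.covector_apply, Fin.sum_univ_four, Kerr.nullCovectorFun_apply_zero,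
    Kerr.nullCovectorFun_apply_one, Kerr.nullCovectorFun_apply_two, Kerr.nullCovectorFun_apply_three,
    radius_kerrCylMap hr₀.le a τ₀ _ hy, kerrCylMap_id_apply_one, kerrCylMap_id_apply_two,
    kerrCylMap_id_apply_three, kerrCylDeriv_id_apply_zero, kerrCylDeriv_id_apply_one,
    kerrCylDeriv_id_apply_two, kerrCylDeriv_id_apply_three, hin]
  rw [← hc, ← hc2]
  field_simp
  ring

/-! ### The closed form and the first-order term -/

/-- **Closed form of the Kerr-cylinder metric as a function of the spin**: for `0 < r₀`, `y ≠ 0`,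
`H₀[m, a](y)(v, w) = η(dψ_a v, dψ_a w) + 2 (m r₀/(r₀² + a² n₃²)) ℓ(dψ_a v) ℓ(dψ_a w)` with the
three closed forms above — a rational function of `a`. [cite: LiMei2020, (4.2)] -/
theorem cylH₀_id_apply_eq (m : ℝ) {r₀ : ℝ} (hr₀ : 0 < r₀) (a τ₀ : ℝ) {y : E3} (hy : y ≠ 0)
    (v w : E3) :
    cylH₀ m a r₀ τ₀ LinearIsometry.id y v w =
      (-(‖y‖⁻¹ * ⟪y, v⟫ * (‖y‖⁻¹ * ⟪y, w⟫)) +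
        (r₀ ^ 2 + a ^ 2) * (tanVec y v 0 * tanVec y w 0 + tanVec y v 1 * tanVec y w 1) +
        r₀ ^ 2 * (tanVec y v 2 * tanVec y w 2)) +
      2 * (m * r₀ / (r₀ ^ 2 + a ^ 2 * dirVec y 2 ^ 2)) *
        ((‖y‖⁻¹ * ⟪y, v⟫ + r₀ * ⟪dirVec y, tanVec y v⟫ +
          a * (dirVec y 1 * tanVec y v 0 - dirVec y 0 * tanVec y v 1)) *
        (‖y‖⁻¹ * ⟪y, w⟫ + r₀ * ⟪dirVec y, tanVec y w⟫ +
          a * (dirVec y 1 * tanVec y w 0 - dirVec y 0 * tanVec y w 1))) := by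
  rw [cylH₀_apply, Kerr.bilin_apply, minkowski_kerrCylDeriv_id, scalarH_kerrCylMap_id m hr₀ a τ₀ hy,
    nullCovector_kerrCylDeriv_id hr₀ a τ₀ hy v, nullCovector_kerrCylDeriv_id hr₀ a τ₀ hy w]

/-- **Li–Mei (4.2), metric part: the first-order term in the spin of the Kerr-cylinder metric.**
For `0 < r₀`, `y ≠ 0` and `v, w ∈ E3`,
`∂_a|_{a=0} H₀[m, a](y)(v, w) = (2m/(r₀‖y‖³)) ((y₂v₁ − y₁v₂) ⟪y, w⟫ + ⟪y, v⟫ (y₂w₁ − y₁w₂))`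
(tree indices: `y 1 * v 0 - y 0 * v 1`), i.e. `ḡ_{m,a} = ḡ_m − 4 m a r₀⁻¹ sin²θ dt dφ + O(a²)`
read on `(dψ v, dψ w)`: `dt(dψ v) = ⟪y, v⟫/‖y‖`, `r₀ sin²θ dφ(dψ w) = −(y₂w₁ − y₁w₂)/‖y‖²`.
[cite: LiMei2020, (4.2)] -/
theorem hasDerivAt_cylH₀_spin (m : ℝ) {r₀ : ℝ} (hr₀ : 0 < r₀) (τ₀ : ℝ) {y : E3} (hy : y ≠ 0)
    (v w : E3) :
    HasDerivAt (fun a : ℝ ↦ cylH₀ m a r₀ τ₀ LinearIsometry.id y v w)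
      (2 * m / (r₀ * ‖y‖ ^ 3) * ((y 1 * v 0 - y 0 * v 1) * ⟪y, w⟫ + ⟪y, v⟫ * (y 1 * w 0 - y 0 * w 1)))
      0 := by
  have hn : ‖y‖ ≠ 0 := norm_ne_zero_iff.2 hy
  -- the closed form, split as `f₁ + f₂` with `f₁` the `η`-part and `f₂` the `2Hℓℓ`-part
  have hfun : (fun a : ℝ ↦ cylH₀ m a r₀ τ₀ LinearIsometry.id y v w) =ᶠ[𝓝 0]
      ((fun a : ℝ ↦ -(‖y‖⁻¹ * ⟪y, v⟫ * (‖y‖⁻¹ * ⟪y, w⟫)) +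
          (r₀ ^ 2 + a * a) * (tanVec y v 0 * tanVec y w 0 + tanVec y v 1 * tanVec y w 1) +
          r₀ ^ 2 * (tanVec y v 2 * tanVec y w 2)) + fun a : ℝ ↦
        2 * (m * r₀ / (r₀ ^ 2 + a * a * dirVec y 2 ^ 2)) *
          ((‖y‖⁻¹ * ⟪y, v⟫ + a * (dirVec y 1 * tanVec y v 0 - dirVec y 0 * tanVec y v 1)) *
            (‖y‖⁻¹ * ⟪y, w⟫ + a * (dirVec y 1 * tanVec y w 0 - dirVec y 0 * tanVec y w 1)))) :=
    Eventually.of_forall fun a ↦ by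
      show cylH₀ m a r₀ τ₀ LinearIsometry.id y v w = _
      rw [Pi.add_apply, cylH₀_id_apply_eq m hr₀ a τ₀ hy v w, inner_dirVec_tanVec hy v,
        inner_dirVec_tanVec hy w]
      ring
  -- abbreviations for the `a`-independent coefficients
  set αv : ℝ := ‖y‖⁻¹ * ⟪y, v⟫ with hαv
  set αw : ℝ := ‖y‖⁻¹ * ⟪y, w⟫ with hαw
  set Q : ℝ := tanVec y v 0 * tanVec y w 0 + tanVec y v 1 * tanVec y w 1 with hQ
  set Q₃ : ℝ := tanVec y v 2 * tanVec y w 2 with hQ₃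
  set Pv : ℝ := dirVec y 1 * tanVec y v 0 - dirVec y 0 * tanVec y v 1 with hPv
  set Pw : ℝ := dirVec y 1 * tanVec y w 0 - dirVec y 0 * tanVec y w 1 with hPw
  set ν : ℝ := dirVec y 2 ^ 2 with hν
  -- differentiate the two rational functions at `a = 0`
  have h1 : HasDerivAt (fun a : ℝ ↦ -(αv * αw) + (r₀ ^ 2 + a * a) * Q + r₀ ^ 2 * Q₃) 0 0 := by
    have h := (((((hasDerivAt_id' (0 : ℝ)).mul (hasDerivAt_id' 0)).const_add (r₀ ^ 2)).mul_const
      Q).const_add (-(αv * αw))).add_const (r₀ ^ 2 * Q₃)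
    exact h.congr_deriv (by ring)
  have hden : HasDerivAt (fun a : ℝ ↦ r₀ ^ 2 + a * a * ν) 0 0 := by
    have h := ((((hasDerivAt_id' (0 : ℝ)).mul (hasDerivAt_id' 0)).mul_const ν).const_add (r₀ ^ 2))
    exact h.congr_deriv (by ring)
  have hH : HasDerivAt (fun a : ℝ ↦ m * r₀ / (r₀ ^ 2 + a * a * ν)) 0 0 := by
    have h := (hasDerivAt_const (0 : ℝ) (m * r₀)).div hden (by positivity)
    exact h.congr_deriv (by ring)
  have hv' : HasDerivAt (fun a : ℝ ↦ αv + a * Pv) Pv 0 :=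
    (((hasDerivAt_id' (0 : ℝ)).mul_const Pv).const_add αv).congr_deriv (by ring)
  have hw' : HasDerivAt (fun a : ℝ ↦ αw + a * Pw) Pw 0 :=
    (((hasDerivAt_id' (0 : ℝ)).mul_const Pw).const_add αw).congr_deriv (by ring)
  have hL : HasDerivAt (fun a : ℝ ↦ (αv + a * Pv) * (αw + a * Pw)) (Pv * αw + αv * Pw) 0 :=
    (hv'.mul hw').congr_deriv (by ring)
  have h2 : HasDerivAt (fun a : ℝ ↦ 2 * (m * r₀ / (r₀ ^ 2 + a * a * ν)) * ((αv + a * Pv) * (αw + a * Pw)))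
      (2 * (m * r₀ / r₀ ^ 2) * (Pv * αw + αv * Pw)) 0 :=
    ((hH.const_mul 2).mul hL).congr_deriv (by ring)
  refine ((h1.add h2).congr_of_eventuallyEq hfun).congr_deriv ?_
  -- identify the constants
  rw [hPv, hPw, hαv, hαw, dirVec_twist hy v, dirVec_twist hy w]
  field_simp
  ring

end LiMei

end Literature.Geometry.Lorentzian

end
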